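import Summits.BirchSwinnertonDyer.Rank1Residual.GaloisImage.CubicKummerIndependence
import Literature.NumberTheory.GaloisRepresentations.ImaginaryQuadraticCyclotomicProofs
import Mathlib.FieldTheory.Galois.Infinite
import Mathlib.NumberTheory.Padics.PadicVal.Basic
import HarnessLib

/-!
# Cubic Kummer independence over `ℚ(μ₃)`: an element of `Gal(ℚ̄/ℚ(μ₃))` fixing `∛B`, moving `ζ₉`
# and moving `∛r` whenever the cube-free support of `r` leaves `B`
# (cell `b2b-bsdres`, team n1011, road E-b / sub-target E-b-1; seat p13)

HONEST FRAMING (cell `b2b-bsdres`, run/shared/lean/b2b/bsd-rank1-residual/, verbatim in every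
file): the goal of the cell is to DELETE the COMBINATION-SHAPED residual classes of the
Birch–Swinnerton-Dyer formula for ALL analytic-rank `≤ 1` elliptic curves over `ℚ` — "full BSD
formula for every rank `≤ 1` curve in class `C`" assembled STRICTLY from published theorems — so
that the rank-`≤ 1` remainder becomes exactly the CONSTRUCTION-SHAPED classes, which are TYPED
(missing-input `Prop`s), NOT attempted. This is not "finishing BSD". Team n1011 (N10/N11, the
additive block `X4 ∧ p = 3`): research route on the CONSTRUCTION-SHAPED class X4 / §I N11
(route-1, road E-b); TOOL theorems of Galois theory / elementary number theory (curve-free);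
nothing booked, no mark / label changed; no definition, no named fact, no `sorry`.

## What and why

ROUTE-1 §64.4 narrows road E-b's crux E-b-1 to "Kummer independence of `B ∪ {3}` over `ℚ(μ₃)` + a
`τ ∈ Γ_{ℚ(μ₃)}` … FIXING the chosen cube roots of `B` and MOVING `ζ₉`" (with the cube roots of `Δ`
moved as well, (R-v⁺)).  This file supplies the Kummer half over `ℚ`, from the generic Galois-side
independence theorem `CubicKummer.exists_mem_forall_smul_ne` (`CubicKummerIndependence`) with
`H = Gal(ℚ̄/ℚ(μ₃)) = rootsOfUnityFixer ℚ 3`: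

* §1 cyclotomic inputs from the surjectivity of the cyclotomic character
  (`Rat.modNCyclotomicCharacter_surjective`): some `g ∈ Γ_ℚ` acts on `μ₃` by squaring
  (`exists_smul_eq_sq_of_pow_three_eq_one`); some `h ∈ Gal(ℚ̄/ℚ(μ₃))` moves `μ₉`
  (`exists_mem_rootsOfUnityFixer_three_not_mem_nine`); `Gal(ℚ̄/ℚ(μ₃))`-fixed elements stay fixed
  under translation by `Γ_ℚ` (`forall_smul_smul_eq_of_forall_smul_eq`).
* §2 the two "no cube" facts in `ℚ(μ₃)` (stated on the fixed field of `Gal(ℚ̄/ℚ(μ₃))` in `ℚ̄`):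
  `ζ₃` is not `q · y³` with `q` `Γ_ℚ`-invariant (`primitiveRoot_ne_mul_cube`), and a rational
  number that is the cube of such a `y` is a rational cube (`exists_rat_pow_three_eq_of_cube`).
* §3 ★ `exists_mem_fixer_cubeRoots_smul_ne_ninthRoot` — for every finite `B ⊆ ℕ ∖ {0}` some
  `σ ∈ Gal(ℚ̄/ℚ(μ₃))` fixes every cube root of every `w ∈ B` and moves every primitive ninth root
  of unity (so `σ ∉ rootsOfUnityFixer ℚ 9`) — "`ζ₉ ∉ ℚ(μ₃, ∛B)`";
  ★ `exists_mem_fixer_cubeRoots_smul_ne_cubeRoot` — if some prime `ℓ` divides no `w ∈ B` and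
  `3 ∤ v_ℓ(r)` (the cube-free support of `r ∈ ℚˣ` is not inside `B`: road E-b's row certificate
  `hΔB`), some `σ ∈ Gal(ℚ̄/ℚ(μ₃))` fixes every cube root of every `w ∈ B` and moves every cube
  root of `r` — "`∛r ∉ ℚ(μ₃, ∛B)`";
  ★★ `exists_mem_fixer_cubeRoots_not_mem_nine_smul_ne_cubeRoot` — ONE `σ` doing both (a subgroup
  of `μ₃ × μ₃` meeting both factors non-trivially has an element non-trivial in both).

References: standard Kummer theory (Neukirch, *Algebraic Number Theory* IV §3; Lang, *Algebra* VI
§8); Washington, *Cyclotomic Fields*, Thm. 2.5 (`Gal(ℚ(μ_N)/ℚ) ≅ (ℤ/N)ˣ`); cells/n1011/ROUTE-1.md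
§61.3 (R-v⁺), §64.4; p02 `E-b-1-RV-NOTE.md` (G2).
-/

noncomputable section

open Field
open Literature.NumberTheory.GaloisRepresentations

namespace Summit.BirchSwinnertonDyer.Rank1Residual.GaloisImage.CubicKummer

/-! ## §1 Cyclotomic inputs over `ℚ` -/

/-- Some `g ∈ Γ_ℚ` acts on the cube roots of unity by squaring (`χ₃(g) = −1`). [folklore] -/
theorem exists_smul_eq_sq_of_pow_three_eq_one :
    ∃ g : absoluteGaloisGroup ℚ, ∀ t : AlgebraicClosure ℚ, t ^ 3 = 1 → g • t = t ^ 2 := by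
  haveI : NeZero (3 : ℕ) := ⟨by norm_num⟩
  haveI : NeZero ((3 : ℕ) : ℚ) := ⟨by norm_num⟩
  obtain ⟨g, hg⟩ := Rat.modNCyclotomicCharacter_surjective 3 (-1)
  refine ⟨g, fun t ht => ?_⟩
  rw [modNCyclotomicCharacter_spec ℚ 3 g t ht, hg]
  rfl

/-- Some `h ∈ Gal(ℚ̄/ℚ(μ₃))` moves every primitive ninth root of unity (`χ₉(h) = 4`); in
particular `Gal(ℚ̄/ℚ(μ₉)) < Gal(ℚ̄/ℚ(μ₃))`. [folklore] -/
theorem exists_mem_rootsOfUnityFixer_three_smul_ne :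
    ∃ h : absoluteGaloisGroup ℚ, h ∈ rootsOfUnityFixer ℚ 3 ∧
      ∀ z : AlgebraicClosure ℚ, IsPrimitiveRoot z 9 → h • z ≠ z := by
  haveI : NeZero (9 : ℕ) := ⟨by norm_num⟩
  haveI : NeZero ((9 : ℕ) : ℚ) := ⟨by norm_num⟩
  obtain ⟨h, hh⟩ := Rat.modNCyclotomicCharacter_surjective 9
    (ZMod.unitOfCoprime 4 (by norm_num : Nat.Coprime 4 9))
  have hval : ((modNCyclotomicCharacter ℚ 9 h : (ZMod 9)ˣ) : ZMod 9).val = 4 := by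
    rw [hh]; rfl
  refine ⟨h, mem_rootsOfUnityFixer_iff.mpr fun t ht => ?_, fun z hz hfix => ?_⟩
  · have ht9 : t ^ 9 = 1 := by
      rw [show (9 : ℕ) = 3 * 3 from rfl, pow_mul, ht, one_pow]
    rw [modNCyclotomicCharacter_spec ℚ 9 h t ht9, hval, show (4 : ℕ) = 3 + 1 from rfl, pow_succ,
      ht, one_mul]
  · rw [modNCyclotomicCharacter_spec ℚ 9 h z hz.pow_eq_one, hval] at hfix
    have h3 : z ^ 3 = 1 := by
      have hz0 : z ≠ 0 := hz.ne_zero (by norm_num)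
      have : z ^ 4 = z ^ 1 := by rw [pow_one]; exact hfix
      rw [show (4 : ℕ) = 3 + 1 from rfl, pow_succ, pow_one] at this
      exact mul_left_eq_self₀.mp this |>.resolve_right hz0
    exact absurd ((hz.pow_eq_one_iff_dvd 3).mp h3) (by norm_num)

/-- `Gal(ℚ̄/ℚ(μ₃)) ⊄ Gal(ℚ̄/ℚ(μ₉))`. [folklore] -/
theorem exists_mem_rootsOfUnityFixer_three_not_mem_nine :
    ∃ h : absoluteGaloisGroup ℚ, h ∈ rootsOfUnityFixer ℚ 3 ∧ h ∉ rootsOfUnityFixer ℚ 9 := by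
  haveI : NeZero ((9 : ℕ) : ℚ) := ⟨by norm_num⟩
  obtain ⟨h, h3, h9⟩ := exists_mem_rootsOfUnityFixer_three_smul_ne
  obtain ⟨z, hz⟩ := HasEnoughRootsOfUnity.exists_primitiveRoot (AlgebraicClosure ℚ) 9
  exact ⟨h, h3, fun hmem => h9 z hz (mem_rootsOfUnityFixer_iff.mp hmem z hz.pow_eq_one)⟩

/-- An element fixed by `Gal(K̄/K(μ_n))` stays fixed after translation by any `g ∈ Γ_K`
(`K(μ_n)/K` is normal: `g⁻¹ h g` again fixes `μ_n`). [folklore] -/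
theorem forall_smul_smul_eq_of_forall_smul_eq {K : Type*} [Field K] {n : ℕ}
    {y : AlgebraicClosure K} (hy : ∀ h ∈ rootsOfUnityFixer K n, h • y = y)
    (g : absoluteGaloisGroup K) : ∀ h ∈ rootsOfUnityFixer K n, h • (g • y) = g • y := by
  intro h hh
  have hconj : g⁻¹ * h * g ∈ rootsOfUnityFixer K n := mem_rootsOfUnityFixer_iff.mpr fun t ht => by
    rw [mul_smul, mul_smul, mem_rootsOfUnityFixer_iff.mp hh (g • t) (by rw [← smul_pow', ht, smul_one]),
      inv_smul_smul]
  have := hy _ hconj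
  rw [mul_smul, mul_smul, inv_smul_eq_iff] at this
  exact this

/-- An element of `Γ_K` fixing a primitive cube root of unity lies in `Gal(K̄/K(μ₃))`. [folklore] -/
theorem mem_rootsOfUnityFixer_three_of_smul_eq {K : Type*} [Field K] {σ : absoluteGaloisGroup K}
    {ω : AlgebraicClosure K} (hω : IsPrimitiveRoot ω 3) (h : σ • ω = ω) :
    σ ∈ rootsOfUnityFixer K 3 := by
  haveI : NeZero (3 : ℕ) := ⟨by norm_num⟩
  refine mem_rootsOfUnityFixer_iff.mpr fun t ht => ?_
  obtain ⟨i, -, rfl⟩ := hω.eq_pow_of_pow_eq_one ht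
  rw [smul_pow', h]

/-- An element of `Γ_K` outside `Gal(K̄/K(μ₃))` squares a primitive cube root of unity. [folklore] -/
theorem smul_eq_sq_of_not_mem_rootsOfUnityFixer_three {K : Type*} [Field K]
    {σ : absoluteGaloisGroup K} {ω : AlgebraicClosure K} (hω : IsPrimitiveRoot ω 3)
    (h : σ ∉ rootsOfUnityFixer K 3) : σ • ω = ω ^ 2 := by
  haveI : NeZero (3 : ℕ) := ⟨by norm_num⟩
  have hne : σ • ω ≠ ω := fun h' => h (mem_rootsOfUnityFixer_three_of_smul_eq hω h')
  obtain ⟨i, hi, hωi⟩ := hω.eq_pow_of_pow_eq_one (ξ := σ • ω)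
    (by rw [← smul_pow', hω.pow_eq_one, smul_one])
  interval_cases i
  · rw [pow_zero] at hωi
    exact absurd (smul_eq_iff_eq_inv_smul σ |>.mp hωi.symm) (by
      rw [smul_one]; exact hω.ne_one (by norm_num))
  · rw [pow_one] at hωi; exact absurd hωi.symm hne
  · exact hωi.symm

/-! ## §2 Two "no cube" facts in `ℚ(μ₃)` -/

/-- **No primitive ninth root of unity is fixed by `Gal(ℚ̄/ℚ(μ₃))`** (`ζ₉ ∉ ℚ(μ₃)`): if
`z³ = ω` with `ω` a primitive cube root of unity, some `h ∈ Gal(ℚ̄/ℚ(μ₃))` moves `z`. [folklore] -/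
theorem exists_mem_smul_ne_of_pow_three_eq_primitiveRoot {ω z : AlgebraicClosure ℚ}
    (hω : IsPrimitiveRoot ω 3) (hz : z ^ 3 = ω) :
    ∃ h ∈ rootsOfUnityFixer ℚ 3, h • z ≠ z := by
  haveI : Fact (Nat.Prime 3) := ⟨Nat.prime_three⟩
  have hz9 : IsPrimitiveRoot z 9 := by
    have h := orderOf_eq_prime_pow (p := 3) (n := 1) (x := z)
      (by rw [pow_one, hz]; exact hω.ne_one (by norm_num))
      (by rw [show 3 ^ (1 + 1) = 3 * 3 from rfl, pow_mul, hz, hω.pow_eq_one])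
    rw [show (9 : ℕ) = 3 ^ (1 + 1) from rfl, ← h]
    exact IsPrimitiveRoot.orderOf z
  obtain ⟨h, h3, h9⟩ := exists_mem_rootsOfUnityFixer_three_smul_ne
  exact ⟨h, h3, h9 z hz9⟩

/-- **`ζ₃ ∉ q · (ℚ̄^{Gal(ℚ̄/ℚ(μ₃))})׳` for `Γ_ℚ`-invariant `q`** (e.g. `q ∈ ℚ`): the Kummer class
of `ζ₃` over `ℚ(μ₃)` is independent of the rationals.  Proof: apply a `g ∈ Γ_ℚ` with `g ζ₃ = ζ₃²`
to `ζ₃ = q y³` and divide — `ζ₃ = (g y / y)³` with `g y / y` fixed by `Gal(ℚ̄/ℚ(μ₃))`, a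
primitive ninth root of unity in `ℚ(μ₃)`. [folklore] -/
theorem primitiveRoot_ne_mul_cube {ω : AlgebraicClosure ℚ} (hω : IsPrimitiveRoot ω 3)
    {q y : AlgebraicClosure ℚ} (hq : ∀ σ : absoluteGaloisGroup ℚ, σ • q = q)
    (hy : ∀ h ∈ rootsOfUnityFixer ℚ 3, h • y = y) : ω ≠ q * y ^ 3 := by
  intro heq
  have hω0 : ω ≠ 0 := hω.ne_zero (by norm_num)
  have hq0 : q ≠ 0 := by rintro rfl; exact hω0 (by rw [heq, zero_mul])
  have hy0 : y ≠ 0 := by rintro rfl; exact hω0 (by rw [heq]; ring)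
  obtain ⟨g, hg⟩ := exists_smul_eq_sq_of_pow_three_eq_one
  have hgω : g • ω = ω ^ 2 := hg ω hω.pow_eq_one
  have hgy : ∀ h ∈ rootsOfUnityFixer ℚ 3, h • (g • y) = g • y :=
    forall_smul_smul_eq_of_forall_smul_eq hy g
  -- `ω² = q (g y)³`
  have heq2 : ω ^ 2 = q * (g • y) ^ 3 := by
    rw [← hgω, heq, smul_mul', hq g, smul_pow']
  -- `z = g y / y` is a cube root of `ω` fixed by `Gal(ℚ̄/ℚ(μ₃))`
  have hz : (g • y / y) ^ 3 = ω := by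
    rw [div_pow, div_eq_iff (pow_ne_zero 3 hy0)]
    have h1 : q * (g • y) ^ 3 = q * (ω * y ^ 3) := by rw [← heq2, sq, heq]; ring
    exact mul_left_cancel₀ hq0 h1
  obtain ⟨h, hh, hne⟩ := exists_mem_smul_ne_of_pow_three_eq_primitiveRoot hω hz
  exact hne (by rw [smul_div₀', hgy h hh, hy h hh])

/-- **A rational number which is the cube of an element of `ℚ(μ₃)` is a rational cube** — stated
on the fixed field of `Gal(ℚ̄/ℚ(μ₃))` in `ℚ̄`: `y³ = r ∈ ℚ` with `y` fixed by `Gal(ℚ̄/ℚ(μ₃))`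
⟹ `r = s³`, `s ∈ ℚ`.  Proof: for `g` with `g ζ₃ = ζ₃²`, `g y = ζ₃^i y`; then `y' = ζ₃^{2i} y`
is fixed by `g` and by `Gal(ℚ̄/ℚ(μ₃))`, hence by `Γ_ℚ = Gal(ℚ̄/ℚ(μ₃)) ∪ g·Gal(ℚ̄/ℚ(μ₃))`, so
`y' ∈ ℚ` (Galois correspondence for `ℚ̄/ℚ`) and `r = y'³`. [folklore] -/
theorem exists_rat_pow_three_eq_of_cube {r : ℚ} {y : AlgebraicClosure ℚ}
    (hy : ∀ h ∈ rootsOfUnityFixer ℚ 3, h • y = y)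
    (hyr : y ^ 3 = algebraMap ℚ (AlgebraicClosure ℚ) r) : ∃ s : ℚ, r = s ^ 3 := by
  haveI : NeZero (3 : ℕ) := ⟨by norm_num⟩
  haveI : NeZero ((3 : ℕ) : ℚ) := ⟨by norm_num⟩
  have hinj : Function.Injective (algebraMap ℚ (AlgebraicClosure ℚ)) :=
    (algebraMap ℚ (AlgebraicClosure ℚ)).injective
  obtain ⟨ω, hω⟩ := HasEnoughRootsOfUnity.exists_primitiveRoot (AlgebraicClosure ℚ) 3
  obtain ⟨g, hg⟩ := exists_smul_eq_sq_of_pow_three_eq_one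
  have hgω : g • ω = ω ^ 2 := hg ω hω.pow_eq_one
  have hgr : g • algebraMap ℚ (AlgebraicClosure ℚ) r = algebraMap ℚ _ r := smul_algebraMap g r
  -- `g y = ω^i y`
  obtain ⟨w, hw, hgy⟩ := exists_smul_eq_mul_of_pow_three_eq g hgr hyr
  obtain ⟨i, -, rfl⟩ := hω.eq_pow_of_pow_eq_one hw
  -- `y' = ω^{2i} y` is fixed by `g` …
  set y' : AlgebraicClosure ℚ := ω ^ (2 * i) * y with hy'
  have hgy' : g • y' = y' := by
    rw [hy', smul_mul', smul_pow', hgω, hgy, ← pow_mul, ← mul_assoc, ← pow_add,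
      show 2 * (2 * i) + i = 3 * i + 2 * i by ring, pow_add, pow_mul, hω.pow_eq_one, one_pow, one_mul]
  -- … and by `Gal(ℚ̄/ℚ(μ₃))`
  have hωfix : ∀ h ∈ rootsOfUnityFixer ℚ 3, h • ω = ω := fun h hh =>
    mem_rootsOfUnityFixer_iff.mp hh ω hω.pow_eq_one
  have hy'3 : ∀ h ∈ rootsOfUnityFixer ℚ 3, h • y' = y' := fun h hh => by
    rw [hy', smul_mul', smul_pow', hωfix h hh, hy h hh]
  -- hence by all of `Γ_ℚ`
  have hall : ∀ σ : absoluteGaloisGroup ℚ, σ • y' = y' := fun σ => by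
    by_cases hσ : σ ∈ rootsOfUnityFixer ℚ 3
    · exact hy'3 σ hσ
    · have hσω : σ • ω = ω ^ 2 := smul_eq_sq_of_not_mem_rootsOfUnityFixer_three hω hσ
      have hginv : g⁻¹ • ω = ω ^ 2 := by
        rw [inv_smul_eq_iff, smul_pow', hgω, ← pow_mul, show 2 * 2 = 3 + 1 from rfl, pow_succ,
          hω.pow_eq_one, one_mul]
      have hρ : g⁻¹ * σ ∈ rootsOfUnityFixer ℚ 3 := mem_rootsOfUnityFixer_three_of_smul_eq hω (by
        rw [mul_smul, hσω, smul_pow', hginv, ← pow_mul, show 2 * 2 = 3 + 1 from rfl, pow_succ,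
          hω.pow_eq_one, one_mul])
      have := hy'3 _ hρ
      rw [mul_smul, inv_smul_eq_iff] at this
      rw [this, hgy']
  -- so `y' ∈ ℚ`
  haveI : IsGalois ℚ (AlgebraicClosure ℚ) := Rat.isGalois_algebraicClosure
  have hbot : y' ∈ (⊥ : IntermediateField ℚ (AlgebraicClosure ℚ)) := by
    rw [← InfiniteGalois.fixedField_fixingSubgroup (⊥ : IntermediateField ℚ (AlgebraicClosure ℚ)),
      IntermediateField.fixingSubgroup_bot, IntermediateField.mem_fixedField_iff]
    exact fun σ _ => hall σ
  obtain ⟨s, hs⟩ := IntermediateField.mem_bot.mp hbot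
  refine ⟨s, hinj ?_⟩
  rw [map_pow, hs, hy', mul_pow, ← pow_mul, show 2 * i * 3 = 3 * (2 * i) by ring, pow_mul,
    hω.pow_eq_one, one_pow, one_mul, hyr]

/-! ## §3 The fixer of `∛B` moving `ζ₉` and `∛r` -/

/-- ★ **`ζ₉ ∉ ℚ(μ₃, ∛B)`, Galois form.**  For every finite set `B` of non-zero naturals and every
primitive cube root of unity `ω`, some `σ ∈ Gal(ℚ̄/ℚ(μ₃))` fixes every cube root of every `w ∈ B`
and moves every `z` with `z³ = ω` (every primitive ninth root of unity `ζ` with `ζ³ = ω`).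
[folklore] -/
theorem exists_mem_fixer_cubeRoots_smul_ne_ninthRoot (B : Finset ℕ) (hB : ∀ w ∈ B, w ≠ 0)
    {ω : AlgebraicClosure ℚ} (hω : IsPrimitiveRoot ω 3) :
    ∃ σ ∈ rootsOfUnityFixer ℚ 3,
      (∀ w ∈ B, ∀ t : AlgebraicClosure ℚ, t ^ 3 = (w : AlgebraicClosure ℚ) → σ • t = t) ∧
      ∀ z : AlgebraicClosure ℚ, z ^ 3 = ω → σ • z ≠ z := by
  classical
  have hnat : ∀ (σ : absoluteGaloisGroup ℚ) (w : ℕ), σ • (w : AlgebraicClosure ℚ) = w :=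
    fun σ w => by rw [← map_natCast (algebraMap ℚ (AlgebraicClosure ℚ)) w, smul_algebraMap]
  obtain ⟨σ, hσ, hfix, hmove⟩ := exists_mem_forall_smul_ne (K := ℚ) (H := rootsOfUnityFixer ℚ 3)
    le_rfl (B.image fun w : ℕ => (w : AlgebraicClosure ℚ))
    (fun s hs => by
      obtain ⟨w, hw, rfl⟩ := Finset.mem_image.mp hs
      exact ⟨Nat.cast_ne_zero.mpr (hB w hw), fun σ _ => hnat σ w⟩)
    (hω.ne_zero (by norm_num)) (fun σ hσ => mem_rootsOfUnityFixer_iff.mp hσ ω hω.pow_eq_one)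
    (fun e y hy => primitiveRoot_ne_mul_cube hω (fun σ => by
      rw [Finset.smul_prod']
      exact Finset.prod_congr rfl fun s hs => by
        obtain ⟨w, -, rfl⟩ := Finset.mem_image.mp hs
        rw [smul_pow', hnat]) hy)
  exact ⟨σ, hσ, fun w hw t ht => hfix _ (Finset.mem_image_of_mem _ hw) t ht, hmove⟩

/-- ★ **`∛r ∉ ℚ(μ₃, ∛B)` when the cube-free support of `r` leaves `B`, Galois form.**  Let `B` be
a finite set of naturals and `r ∈ ℚ` such that some prime `ℓ` divides no `w ∈ B` and
`3 ∤ v_ℓ(r)`.  Then some `σ ∈ Gal(ℚ̄/ℚ(μ₃))` fixes every cube root of every `w ∈ B` and moves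
every cube root of `r`.  (If `σ` failed to exist, `r = (∏ w^{e_w}) y³` with `y ∈ ℚ(μ₃)`, so
`r / ∏ w^{e_w}` is a rational cube and `3 ∣ v_ℓ(r)`.) [folklore] -/
theorem exists_mem_fixer_cubeRoots_smul_ne_cubeRoot (B : Finset ℕ) {r : ℚ}
    (hrB : ∃ ℓ : ℕ, ℓ.Prime ∧ (∀ w ∈ B, ¬ ℓ ∣ w) ∧ ¬ (3 : ℤ) ∣ padicValRat ℓ r) :
    ∃ σ ∈ rootsOfUnityFixer ℚ 3,
      (∀ w ∈ B, ∀ t : AlgebraicClosure ℚ, t ^ 3 = (w : AlgebraicClosure ℚ) → σ • t = t) ∧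
      ∀ δ : AlgebraicClosure ℚ, δ ^ 3 = algebraMap ℚ (AlgebraicClosure ℚ) r → σ • δ ≠ δ := by
  classical
  obtain ⟨ℓ, hℓ, hℓB, hℓr⟩ := hrB
  haveI : Fact ℓ.Prime := ⟨hℓ⟩
  have hr : r ≠ 0 := by
    rintro rfl
    exact hℓr (by rw [padicValRat.zero]; exact dvd_zero 3)
  have hB : ∀ w ∈ B, w ≠ 0 := fun w hw h0 => hℓB w hw (by rw [h0]; exact dvd_zero ℓ)
  have hnat : ∀ (σ : absoluteGaloisGroup ℚ) (w : ℕ), σ • (w : AlgebraicClosure ℚ) = w :=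
    fun σ w => by rw [← map_natCast (algebraMap ℚ (AlgebraicClosure ℚ)) w, smul_algebraMap]
  have hinj : Function.Injective (algebraMap ℚ (AlgebraicClosure ℚ)) :=
    (algebraMap ℚ (AlgebraicClosure ℚ)).injective
  obtain ⟨σ, hσ, hfix, hmove⟩ := exists_mem_forall_smul_ne (K := ℚ) (H := rootsOfUnityFixer ℚ 3)
    le_rfl (B.image fun w : ℕ => (w : AlgebraicClosure ℚ))
    (fun s hs => by
      obtain ⟨w, hw, rfl⟩ := Finset.mem_image.mp hs
      exact ⟨Nat.cast_ne_zero.mpr (hB w hw), fun σ _ => hnat σ w⟩)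
    (c := algebraMap ℚ (AlgebraicClosure ℚ) r)
    (by rw [Ne, map_eq_zero_iff _ hinj]; exact hr) (fun σ _ => smul_algebraMap σ r)
    (fun e y hy heq => by
      -- the product over `B` is the rational `P₀ = ∏ w^{e_w}`
      set P₀ : ℕ := ∏ w ∈ B, w ^ e (w : AlgebraicClosure ℚ) with hP₀
      have hP : (∏ s ∈ B.image (fun w : ℕ => (w : AlgebraicClosure ℚ)), s ^ e s) =
          algebraMap ℚ (AlgebraicClosure ℚ) (P₀ : ℚ) := by
        rw [Finset.prod_image fun w _ w' _ h => Nat.cast_injective h, hP₀, map_natCast,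
          Nat.cast_prod]
        exact Finset.prod_congr rfl fun w _ => by rw [Nat.cast_pow]
      have hP₀ℓ : ¬ ℓ ∣ P₀ := by
        rw [hP₀]
        exact (Nat.prime_iff.mp hℓ).not_dvd_finsetProd fun w hw h => hℓB w hw (hℓ.dvd_of_dvd_pow h)
      have hP₀0 : (P₀ : ℚ) ≠ 0 := Nat.cast_ne_zero.mpr fun h => hP₀ℓ (by rw [h]; exact dvd_zero ℓ)
      -- `y³ = r / P₀`, so `r / P₀` is a rational cube
      have hy3 : y ^ 3 = algebraMap ℚ (AlgebraicClosure ℚ) (r / P₀) := by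
        rw [map_div₀, ← hP, eq_div_iff (by rw [hP, Ne, map_eq_zero_iff _ hinj]; exact hP₀0), mul_comm,
          ← heq]
      obtain ⟨s, hs⟩ := exists_rat_pow_three_eq_of_cube hy hy3
      have hs0 : s ≠ 0 := by
        rintro rfl
        rw [zero_pow three_ne_zero, div_eq_zero_iff] at hs
        exact hs.elim hr hP₀0
      -- valuations: `v_ℓ(r) = v_ℓ(P₀) + 3 v_ℓ(s) = 3 v_ℓ(s)`
      have hrv : r = (P₀ : ℚ) * s ^ 3 := by rw [← hs, mul_div_cancel₀ _ hP₀0]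
      apply hℓr
      rw [hrv, padicValRat.mul hP₀0 (pow_ne_zero 3 hs0), padicValRat.pow s, padicValRat.of_nat,
        padicValNat.eq_zero_of_not_dvd hP₀ℓ, Nat.cast_zero, zero_add, Nat.cast_ofNat]
      exact dvd_mul_right 3 _)
  exact ⟨σ, hσ, fun w hw t ht => hfix _ (Finset.mem_image_of_mem _ hw) t ht, hmove⟩

/-- ★★ **E-b-1's Kummer datum: ONE `σ ∈ Gal(ℚ̄/ℚ(μ₃))` fixing `∛B`, moving `ζ₉`, moving `∛r`.**
Let `B` be a finite set of naturals and `r ∈ ℚ` such that some prime `ℓ` divides no `w ∈ B` and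
`3 ∤ v_ℓ(r)` (road E-b's row certificate `hΔB` for `r = Δ`).  Then there is
`σ ∈ rootsOfUnityFixer ℚ 3` with `σ ∉ rootsOfUnityFixer ℚ 9` which fixes every `t` with
`t³ = w`, `w ∈ B`, and moves every cube root of `r` in `ℚ̄`.  (From the two ★ theorems: if `σ₁`
moves `ζ₉` and `σ₂` moves `∛r`, one of `σ₁`, `σ₂`, `σ₁σ₂` does both.) [folklore] -/
theorem exists_mem_fixer_cubeRoots_not_mem_nine_smul_ne_cubeRoot (B : Finset ℕ) {r : ℚ}
    (hrB : ∃ ℓ : ℕ, ℓ.Prime ∧ (∀ w ∈ B, ¬ ℓ ∣ w) ∧ ¬ (3 : ℤ) ∣ padicValRat ℓ r) :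
    ∃ σ ∈ rootsOfUnityFixer ℚ 3, σ ∉ rootsOfUnityFixer ℚ 9 ∧
      (∀ w ∈ B, ∀ t : AlgebraicClosure ℚ, t ^ 3 = (w : AlgebraicClosure ℚ) → σ • t = t) ∧
      ∀ δ : AlgebraicClosure ℚ, δ ^ 3 = algebraMap ℚ (AlgebraicClosure ℚ) r → σ • δ ≠ δ := by
  haveI : NeZero ((3 : ℕ) : ℚ) := ⟨by norm_num⟩
  have hinj : Function.Injective (algebraMap ℚ (AlgebraicClosure ℚ)) :=
    (algebraMap ℚ (AlgebraicClosure ℚ)).injective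
  obtain ⟨ℓ, hℓ, hℓB, hℓr⟩ := hrB
  have hr : r ≠ 0 := by
    haveI : Fact ℓ.Prime := ⟨hℓ⟩
    rintro rfl
    exact hℓr (by rw [padicValRat.zero]; exact dvd_zero 3)
  have hc0 : algebraMap ℚ (AlgebraicClosure ℚ) r ≠ 0 := by
    rw [Ne, map_eq_zero_iff _ hinj]; exact hr
  have hB : ∀ w ∈ B, w ≠ 0 := fun w hw h0 => hℓB w hw (by rw [h0]; exact dvd_zero ℓ)
  obtain ⟨ω, hω⟩ := HasEnoughRootsOfUnity.exists_primitiveRoot (AlgebraicClosure ℚ) 3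
  obtain ⟨z₀, hz₀⟩ := IsAlgClosed.exists_pow_nat_eq ω (by norm_num : 0 < 3)
  obtain ⟨δ₀, hδ₀⟩ := IsAlgClosed.exists_pow_nat_eq (algebraMap ℚ (AlgebraicClosure ℚ) r)
    (by norm_num : 0 < 3)
  have hz₀9 : z₀ ^ 9 = 1 := by
    rw [show (9 : ℕ) = 3 * 3 from rfl, pow_mul, hz₀, hω.pow_eq_one]
  -- "moves `z₀`" gives `∉ rootsOfUnityFixer ℚ 9`; "moves `δ₀`" gives "moves every cube root of `r`"
  have key : ∀ σ ∈ rootsOfUnityFixer ℚ 3, σ • z₀ ≠ z₀ → σ • δ₀ ≠ δ₀ →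
      (∀ w ∈ B, ∀ t : AlgebraicClosure ℚ, t ^ 3 = (w : AlgebraicClosure ℚ) → σ • t = t) →
      ∃ σ ∈ rootsOfUnityFixer ℚ 3, σ ∉ rootsOfUnityFixer ℚ 9 ∧
        (∀ w ∈ B, ∀ t : AlgebraicClosure ℚ, t ^ 3 = (w : AlgebraicClosure ℚ) → σ • t = t) ∧
        ∀ δ : AlgebraicClosure ℚ, δ ^ 3 = algebraMap ℚ (AlgebraicClosure ℚ) r → σ • δ ≠ δ :=
    fun σ hσ hz hδ hfix => ⟨σ, hσ, fun h9 => hz (mem_rootsOfUnityFixer_iff.mp h9 z₀ hz₀9), hfix,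
      fun δ hδ' => smul_ne_self_of_pow_three_eq hσ hc0 hδ₀ hδ hδ'⟩
  obtain ⟨σ₁, hσ₁, hfix₁, hmove₁⟩ := exists_mem_fixer_cubeRoots_smul_ne_ninthRoot B hB hω
  obtain ⟨σ₂, hσ₂, hfix₂, hmove₂⟩ := exists_mem_fixer_cubeRoots_smul_ne_cubeRoot B ⟨ℓ, hℓ, hℓB, hℓr⟩
  by_cases h₁ : σ₁ • δ₀ = δ₀
  · by_cases h₂ : σ₂ • z₀ = z₀
    · -- `σ₁ σ₂` moves both
      refine key (σ₁ * σ₂) (Subgroup.mul_mem _ hσ₁ hσ₂) ?_ ?_ fun w hw t ht => ?_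
      · rw [mul_smul, h₂]; exact hmove₁ z₀ hz₀
      · obtain ⟨w, hw, hσ₂δ⟩ := exists_smul_eq_mul_of_pow_three_eq σ₂ (smul_algebraMap σ₂ r) hδ₀
        rw [mul_smul, hσ₂δ, smul_mul', mem_rootsOfUnityFixer_iff.mp hσ₁ w hw, h₁, ← hσ₂δ]
        exact hmove₂ δ₀ hδ₀
      · rw [mul_smul, hfix₂ w hw t ht, hfix₁ w hw t ht]
    · exact key σ₂ hσ₂ h₂ (hmove₂ δ₀ hδ₀) hfix₂
  · exact key σ₁ hσ₁ (hmove₁ z₀ hz₀) h₁ hfix₁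

end Summit.BirchSwinnertonDyer.Rank1Residual.GaloisImage.CubicKummer

end
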